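import Summits.HodgeConjecture.HodgeConjecture.Theorems.UeP4N3corePairReadingPiece
import Summits.HodgeConjecture.HodgeConjecture.Theorems.SiegelUniversalFamilyCupFrameIndependentPiece
import Literature.AlgebraicGeometry.HodgeTheory.FlatFrameCoefficientsOfGlobalClass
import HarnessLib

/-!
# U-e (N3-core) ON A SMOOTH CLOPEN PIECE: the polarisation Gram is flat in a flat integral frame — PROVED

Sub-problem `HodgeConjecture` (cell HC_CM, (U)-lane node U-e P4, G-AN1 «P4 local on the base / P4 on a smooth clopen piece»;
P4 lead / assembler B-p03 (g14)).  PIECE EDITION of ★ `UnivFamilyN3core.ue_N3core_holds` (`Theorems/UeP4N3core.lean`): the base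
`M ⊗ ℂ` of the complexified universal family of the Siegel fine moduli scheme is replaced by a smooth quasi-projective piece
`ι : S′ ⟶ M ⊗ ℂ` (an open immersion, `S′` smooth of relative dimension `d`), the family by its pullback
`familyPullback.snd (univFamilyℂ 𝓜) ι`, fibre triples are classified at `ι(x)` and the pinned identification is extended by ★
`Motives.fiberOverFamilyPullbackIso`.  Statement: for a flat integral frame `γ` of `R¹f′_*ℚ` over a path-connected `W ⊆ S′(ℂ)`,
framed additive uniformisations and ample `IsLambdaOfAt` witnesses, the INTEGER Gram matrix of the Appell–Humbert form of
`𝒪(Θ y)^an` in the lattice basis is the same at any two points of `W` ([LangeBirkenhake1992] Ch. 8 §8.1; [VoisinHodgeII2003]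
§3.1.2; [MumfordFogartyKirwan1994] Ch. 6 §2 Prop. 6.10).  PROOF = the global glue verbatim over the two PIECE sockets: (R-piece)
`UnivFamilyPairReadingPiece.ue_N3asm_pairReading_piece_holds` and (I-piece) `UnivFamilyCupFrame.ue_N3asm_cupFrameIndependent_piece_holds`
(B-p12 (g13)); then a path in `W`, transport of the restrictions of `C` (★ `transportFun_map_fiberι`) and of the cup frame (★
`transportFun_cupProduct` + flatness), ordered double sums, ★ L6 `coeff_eq_of_transportFun_eq_sum`, cancelling `c` and `2`, and
equality of antisymmetric integer matrices with equal strict upper triangles.  Main result: `ue_N3core_piece_holds` (the lead's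
socket text `UHead.Ue_N3core_flatPolarisationGram_piece` with `IsFlatIntegralFrame` spelled out).  HC_CM is proved only modulo the
7 printed citations until rung 0 closes; this helper changes no count.

## References
* [LangeBirkenhake1992] H. Lange, Ch. Birkenhake, *Complex Abelian Varieties*, Springer 1992, Ch. 8 §8.1.
* [VoisinHodgeII2003] C. Voisin, *Hodge Theory and Complex Algebraic Geometry II*, CUP 2003, §3.1.2.
* [VoisinHodgeI2002] C. Voisin, *Hodge Theory and Complex Algebraic Geometry I*, CUP 2002, §9.2.1.
* [MumfordFogartyKirwan1994] D. Mumford, J. Fogarty, F. Kirwan, *Geometric Invariant Theory*, 3rd ed., Ch. 6 §2 Prop. 6.10 (p. 121).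
-/

set_option autoImplicit false
set_option linter.dupNamespace false

noncomputable section

open CategoryTheory CategoryTheory.Limits AlgebraicGeometry Matrix Topology
open Literature.AlgebraicGeometry
open Literature.AlgebraicGeometry.Motives (SchemeOver ComplexPoints AlgPoints specOver AbelianVariety CartierDivisor fiberOver)
open Literature.AlgebraicGeometry.HodgeTheory (ofRatClass transportFun transportFun_map_fiberι transportFun_cupProduct
  coeff_eq_of_transportFun_eq_sum)
open Literature.AlgebraicGeometry.AbelianSchemes (PolarizedAbelianSchemeWithLevel AbelianSchemeOver)
open Literature.AlgebraicGeometry.ModuliOfAbelianVarieties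
open Literature.AlgebraicGeometry.ModuliOfAbelianVarieties.SiegelModuli
open Literature.Geometry.Kaehler (ComplexTorus)
open Literature.NumberTheory.Transcendental (IsAnalytification)
open Literature.NumberTheory.Automorphic (siegelUpperHalfSpace)
open Literature.NumberTheory.Adeles
open Literature.AlgebraicTopology.SingularHomology

namespace Summit.HodgeConjecture.HodgeConjecture.Theorems

namespace UnivFamilyN3corePiece

/-! ### §1 Order-free double sums over an antisymmetric integer matrix against an antisymmetric family -/

section DoubleSum

variable {ι : Type} [Fintype ι] {n : ℕ} (e : ι ≃ Fin n) {V : Type} [AddCommGroup V] [Module ℂ V]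

omit [Fintype ι] in
/-- An antisymmetric integer matrix has zero diagonal. [folklore] -/
private theorem diag_eq_zero_of_antisymm {M : Matrix ι ι ℤ} (hM : ∀ a b, M b a = -M a b) (a : ι) : M a a = 0 := by
  have h := hM a a
  omega

/-- **Order-free double sum = twice the ordered sum** for an antisymmetric integer coefficient matrix against an antisymmetric
family of vectors: `Σ_a Σ_b M_ab • v_ab = Σ_{a<b} (2 M_ab) • v_ab` (order through `e : ι ≃ Fin n`). [folklore] -/
private theorem sum_sum_eq_sum_lt {M : Matrix ι ι ℤ} (hM : ∀ a b, M b a = -M a b) {v : ι → ι → V}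
    (hv : ∀ a b, v b a = -v a b) :
    ∑ a, ∑ b, ((M a b : ℤ) : ℂ) • v a b =
      ∑ j : {ab : ι × ι // e ab.1 < e ab.2}, ((2 * M j.1.1 j.1.2 : ℤ) : ℂ) • v j.1.1 j.1.2 := by
  classical
  -- the double sum as a sum over `ι × ι`, split by the trichotomy of `e a` vs `e b`
  rw [← Finset.sum_product' (f := fun a b ↦ ((M a b : ℤ) : ℂ) • v a b), Finset.univ_product_univ]
  have hsplit : (Finset.univ : Finset (ι × ι)) =
      (Finset.univ.filter fun ab : ι × ι ↦ e ab.1 < e ab.2) ∪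
        ((Finset.univ.filter fun ab : ι × ι ↦ e ab.1 = e ab.2) ∪
          (Finset.univ.filter fun ab : ι × ι ↦ e ab.2 < e ab.1)) := by
    ext ab
    simp only [Finset.mem_univ, Finset.mem_union, Finset.mem_filter, true_and, true_iff]
    rcases lt_trichotomy (e ab.1) (e ab.2) with h | h | h
    · exact Or.inl h
    · exact Or.inr (Or.inl h)
    · exact Or.inr (Or.inr h)
  have hd₁ : Disjoint (Finset.univ.filter fun ab : ι × ι ↦ e ab.1 = e ab.2)
      (Finset.univ.filter fun ab : ι × ι ↦ e ab.2 < e ab.1) := by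
    rw [Finset.disjoint_filter]
    intro ab _ h h'
    exact absurd h (ne_of_gt h')
  have hd₂ : Disjoint (Finset.univ.filter fun ab : ι × ι ↦ e ab.1 < e ab.2)
      ((Finset.univ.filter fun ab : ι × ι ↦ e ab.1 = e ab.2) ∪
        (Finset.univ.filter fun ab : ι × ι ↦ e ab.2 < e ab.1)) := by
    rw [Finset.disjoint_union_right, Finset.disjoint_filter, Finset.disjoint_filter]
    exact ⟨fun ab _ h h' ↦ absurd h' (ne_of_lt h), fun ab _ h h' ↦ absurd (h.trans h') (lt_irrefl _)⟩
  rw [hsplit, Finset.sum_union hd₂, Finset.sum_union hd₁]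
  -- the diagonal vanishes
  have hdiag : ∑ ab ∈ Finset.univ.filter (fun ab : ι × ι ↦ e ab.1 = e ab.2), ((M ab.1 ab.2 : ℤ) : ℂ) • v ab.1 ab.2 = 0 := by
    refine Finset.sum_eq_zero fun ab hab ↦ ?_
    have h : ab.1 = ab.2 := e.injective (Finset.mem_filter.1 hab).2
    rw [h, diag_eq_zero_of_antisymm hM, Int.cast_zero, zero_smul]
  -- the lower triangle equals the upper triangle (swap)
  have hlow : ∑ ab ∈ Finset.univ.filter (fun ab : ι × ι ↦ e ab.2 < e ab.1), ((M ab.1 ab.2 : ℤ) : ℂ) • v ab.1 ab.2 =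
      ∑ ab ∈ Finset.univ.filter (fun ab : ι × ι ↦ e ab.1 < e ab.2), ((M ab.1 ab.2 : ℤ) : ℂ) • v ab.1 ab.2 := by
    refine Finset.sum_bij' (fun ab _ ↦ ab.swap) (fun ab _ ↦ ab.swap) ?_ ?_ ?_ ?_ ?_
    · intro ab hab; simpa using (Finset.mem_filter.1 hab).2
    · intro ab hab; simpa using (Finset.mem_filter.1 hab).2
    · intro ab _; simp
    · intro ab _; simp
    · intro ab _
      simp only [Prod.fst_swap, Prod.snd_swap]
      rw [hM ab.1 ab.2, hv ab.1 ab.2, Int.cast_neg, neg_smul_neg]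
  rw [hdiag, zero_add, hlow, ← Finset.sum_add_distrib]
  -- re-index the filtered sum by the subtype
  rw [Finset.sum_subtype (Finset.univ.filter fun ab : ι × ι ↦ e ab.1 < e ab.2)
    (p := fun ab : ι × ι ↦ e ab.1 < e ab.2) (fun ab ↦ by simp)]
  refine Finset.sum_congr rfl fun j _ ↦ ?_
  rw [← add_smul, ← Int.cast_add, ← two_mul]

omit [Fintype ι] in
/-- Two antisymmetric integer matrices with the same strict upper triangle (order through `e`) are equal. [folklore] -/
private theorem eq_of_antisymm_of_upper {M M' : Matrix ι ι ℤ} (hM : ∀ a b, M b a = -M a b) (hM' : ∀ a b, M' b a = -M' a b)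
    (h : ∀ a b, e a < e b → M a b = M' a b) : M = M' := by
  ext a b
  rcases lt_trichotomy (e a) (e b) with hab | hab | hab
  · exact h a b hab
  · rw [e.injective hab, diag_eq_zero_of_antisymm hM, diag_eq_zero_of_antisymm hM']
  · rw [hM b a, hM' b a, h b a hab]

end DoubleSum

/-! ### §2 The engine -/

/-- **(N3-core) ON A PIECE PROVED — `ue_N3core_piece_holds`**: the lead's socket `UHead.Ue_N3core_flatPolarisationGram_piece`
(PieceSockets.v1 text, with `IsFlatIntegralFrame` spelled as its three clauses).
[cite: LangeBirkenhake1992, Ch. 8 §8.1] [cite: VoisinHodgeII2003, §3.1.2] [cite: MumfordFogartyKirwan1994, Ch. 6 §2 Prop. 6.10 (p. 121)] -/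
theorem ue_N3core_piece_holds :
    ∀ (g N : ℕ) (δ : Fin g → ℕ) (_hg : 0 < g) (_hδ : IsPolarizationType δ) (_hN : 3 ≤ N)
      (𝓜 : SiegelFineModuliScheme g N δ) (_hMq : HodgeTheory.IsQuasiProjectiveOver 𝓜.M)
      (_hXq : HodgeTheory.IsQuasiProjectiveOver (W1.univTotal 𝓜))
      {S' : SchemeOver ℂ} (ι : S' ⟶ (Motives.baseChange ℚ ℂ).obj 𝓜.M) [IsOpenImmersion ι.left]
      (_hSq : HodgeTheory.IsQuasiProjectiveOver S') (d : ℕ) [SmoothOfRelativeDimension d S'.hom],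
      haveI : IsLocallyNoetherian (specOver ℚ ℂ).left :=
        inferInstanceAs (IsLocallyNoetherian (Spec (CommRingCat.of ℂ)))
      ∀ (W : Set (ComplexPoints S')) (_hW : IsPathConnected W)
        (hU : HodgeTheory.IsCohomologicallyLocallyTrivialOn (Motives.familyPullback.snd (W1.univFamilyℂ 𝓜) ι) W)
        (P' : W → PolarizedAbelianSchemeWithLevel g N δ (specOver ℚ ℂ).left)
        (G : ∀ x : W, (P' x).A.X.left ⟶ 𝓜.univ.A.X.left) (Ĝ : ∀ x : W, (P' x).D.hat.X.left ⟶ 𝓜.univ.D.hat.X.left)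
        (hbc : ∀ x : W, (P' x).IsBaseChangeVia 𝓜.univ
          ((AlgPoints.baseChangeEquiv (algebraMap ℚ ℂ) 𝓜.M).symm (AlgPoints.map (L := ℂ) ι x.1)).left (G x) (Ĝ x))
        (γ : ∀ x : W, Fin g ⊕ Fin g →
          singularCohomology ℚ ℚ (ComplexPoints (fiberOver (Motives.familyPullback.snd (W1.univFamilyℂ 𝓜) ι) x.1)) 1)
        (Φ : ∀ _x : W, (Fin g ⊕ Fin g → ℝ) ≃L[ℝ] (Fin g → ℂ))
        (φ : ∀ x : W, C(ComplexTorus (Φ x), ((P' x).A.fibre (𝟙 (Spec (CommRingCat.of ℂ)))).toAbelianVariety.Points ℂ))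
        (hφ : ∀ x : W, IsAnalytification (Fin g → ℂ)
          ((P' x).A.fibre (𝟙 (Spec (CommRingCat.of ℂ)))).toAbelianVariety.X
          ((P' x).A.fibre (𝟙 (Spec (CommRingCat.of ℂ)))).toAbelianVariety.dim (φ x))
        (Θ : ∀ x : W, CartierDivisor ((P' x).A.fibre (𝟙 (Spec (CommRingCat.of ℂ)))).toAbelianVariety.X.left),
        ((∀ x : W, LinearIndependent ℂ fun a => HodgeTheory.ofRatClass _ 1 (γ x a)) ∧
          (∀ (x : W) (c : HodgeTheory.complexBetti (fiberOver (Motives.familyPullback.snd (W1.univFamilyℂ 𝓜) ι) x.1) 1),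
              HodgeTheory.IsIntegralClass c ↔
                c ∈ Submodule.span ℤ (Set.range fun a => HodgeTheory.ofRatClass _ 1 (γ x a))) ∧
          ∀ (x x' : W) (p : Path.Homotopic.Quotient x x') (a : Fin g ⊕ Fin g),
            HodgeTheory.transportFun (Motives.familyPullback.snd (W1.univFamilyℂ 𝓜) ι) 1 hU p (HodgeTheory.ofRatClass _ 1 (γ x a)) =
              HodgeTheory.ofRatClass _ 1 (γ x' a)) →
        (∀ (x : W) (s t : ComplexTorus (Φ x)), φ x (s + t) = φ x s * φ x t) →
        (∀ (x : W) (a : Fin g ⊕ Fin g),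
          singularCohomology.map ℚ ℚ
              (((Motives.AlgPoints.homeomorphOfIso (L := ℂ)
                  (W1.fibreAVIso (P' x) ≪≫
                    (W1.fiberUnivIsoOfIsBaseChangeVia 𝓜 (AlgPoints.map (L := ℂ) ι x.1) (P' x) (G x) (Ĝ x) (hbc x)).symm ≪≫
                    (Motives.fiberOverFamilyPullbackIso (W1.univFamilyℂ 𝓜) ι x.1).symm) :
                  ((P' x).A.fibre (𝟙 (Spec (CommRingCat.of ℂ)))).toAbelianVariety.Points ℂ ≃ₜ
                    ComplexPoints (fiberOver (Motives.familyPullback.snd (W1.univFamilyℂ 𝓜) ι) x.1)) :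
                C(((P' x).A.fibre (𝟙 (Spec (CommRingCat.of ℂ)))).toAbelianVariety.Points ℂ,
                  ComplexPoints (fiberOver (Motives.familyPullback.snd (W1.univFamilyℂ 𝓜) ι) x.1))).comp (φ x)) 1 (γ x a) =
            HodgeTheory.latticeClass (Φ x) a) →
        (∀ x : W, (Θ x).IsAmple) →
        (∀ x : W, (P' x).A.IsLambdaOfAt (𝟙 (Spec (CommRingCat.of ℂ))) (P' x).D (P' x).pol.lam (Θ x)) →
        ∀ (x₀ x : W) (p₀ : ComplexTorus.AHData (Φ x₀)) (p : ComplexTorus.AHData (Φ x)),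
          ComplexTorus.AHData.toPic p₀ =
              ComplexTorus.picClass (HodgeTheory.cartierDivisorLineBundle (hφ x₀) (Θ x₀)) →
          ComplexTorus.AHData.toPic p =
              ComplexTorus.picClass (HodgeTheory.cartierDivisorLineBundle (hφ x) (Θ x)) →
          ComplexTorus.intGram (Φ x) p.form = ComplexTorus.intGram (Φ x₀) p₀.form := by
  intro g N δ hg hδ hN 𝓜 hMq hXq S' ι _ hSq d _ W hW hU P' G Ĝ hbc γ Φ φ hφ Θ hflat hadd hframe hΘ hlam x₀ x p₀ p hp₀ hp
  classical
  obtain ⟨C, c, hc, hr₀, hr⟩ :=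
    UnivFamilyPairReadingPiece.ue_N3asm_pairReading_piece_holds g N δ hg hδ hN 𝓜 hMq hXq ι hSq d W hW hU P' G Ĝ hbc γ Φ φ hφ Θ
      hflat hadd
      hframe hΘ hlam x₀ x p₀ p hp₀ hp
  have h11 : 1 + 1 = 2 := rfl
  let e : (Fin g ⊕ Fin g) ≃ Fin (g + g) := finSumFinEquiv
  -- the ordered cup frame over `W`
  let β : ∀ y : W, {ab : (Fin g ⊕ Fin g) × (Fin g ⊕ Fin g) // e ab.1 < e ab.2} →
      HodgeTheory.complexBetti (fiberOver (Motives.familyPullback.snd (W1.univFamilyℂ 𝓜) ι) y.1) 2 := fun y j ↦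
    cupProduct h11 (ofRatClass _ 1 (γ y j.1.1)) (ofRatClass _ 1 (γ y j.1.2))
  -- a path from `x₀` to `x` inside `W`
  obtain ⟨pth⟩ := (hW.joinedIn x₀.1 x₀.2 x.1 x.2).joined_subtype
  -- the frame is carried to itself by transport (flatness clause (iii) + ★ `transportFun_cupProduct`)
  have hβ : ∀ j, transportFun (Motives.familyPullback.snd (W1.univFamilyℂ 𝓜) ι) 2 hU ⟦pth⟧ (β x₀ j) = β x j := by
    intro j
    change transportFun (Motives.familyPullback.snd (W1.univFamilyℂ 𝓜) ι) 2 hU ⟦pth⟧ (cupProduct h11 _ _) = cupProduct h11 _ _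
    rw [transportFun_cupProduct (Motives.familyPullback.snd (W1.univFamilyℂ 𝓜) ι) hU h11, hflat.2.2 x₀ x _ j.1.1, hflat.2.2 x₀ x _ j.1.2]
  -- independence of the ordered cup frame at `x` (★ (I-piece), B-p12 (g13))
  have hind : LinearIndependent ℂ (β x) :=
    UnivFamilyCupFrame.ue_N3asm_cupFrameIndependent_piece_holds g N δ hg hδ hN 𝓜 ι x.1 (P' x) (G x) (Ĝ x) (hbc x) (γ x) (Φ x)
      (φ x) (hφ x) (hframe x)
  -- antisymmetries
  have hM₀ : ∀ a b, ComplexTorus.intGram (Φ x₀) p₀.form b a = -ComplexTorus.intGram (Φ x₀) p₀.form a b := fun a b ↦ by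
    have h := congrFun (congrFun (ComplexTorus.intGram_transpose_of_isNSForm (Φ x₀) p₀.isNSForm_form) a) b
    simpa [Matrix.transpose_apply, Matrix.neg_apply] using h
  have hM : ∀ a b, ComplexTorus.intGram (Φ x) p.form b a = -ComplexTorus.intGram (Φ x) p.form a b := fun a b ↦ by
    have h := congrFun (congrFun (ComplexTorus.intGram_transpose_of_isNSForm (Φ x) p.isNSForm_form) a) b
    simpa [Matrix.transpose_apply, Matrix.neg_apply] using h
  have hv : ∀ (y : W) (a b : Fin g ⊕ Fin g),
      cupProduct h11 (ofRatClass _ 1 (γ y b)) (ofRatClass _ 1 (γ y a)) =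
        -cupProduct h11 (ofRatClass _ 1 (γ y a)) (ofRatClass _ 1 (γ y b)) := by
    intro y a b
    rw [cupProduct_gradedComm_holds ℂ _ h11 h11 (ofRatClass _ 1 (γ y b)) (ofRatClass _ 1 (γ y a))]
    simp
  -- the two readings over the ORDERED frame
  have hr₀' : HodgeTheory.complexBetti.map (Motives.fiberι (Motives.familyPullback.snd (W1.univFamilyℂ 𝓜) ι) x₀.1) 2 C =
      ∑ j, (c * ((2 * ComplexTorus.intGram (Φ x₀) p₀.form j.1.1 j.1.2 : ℤ) : ℂ)) • β x₀ j := by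
    rw [hr₀, sum_sum_eq_sum_lt e hM₀ (hv x₀), Finset.smul_sum]
    refine Finset.sum_congr rfl fun j _ ↦ ?_
    rw [smul_smul]
  have hr' : HodgeTheory.complexBetti.map (Motives.fiberι (Motives.familyPullback.snd (W1.univFamilyℂ 𝓜) ι) x.1) 2 C =
      ∑ j, (c * ((2 * ComplexTorus.intGram (Φ x) p.form j.1.1 j.1.2 : ℤ) : ℂ)) • β x j := by
    rw [hr, sum_sum_eq_sum_lt e hM (hv x), Finset.smul_sum]
    refine Finset.sum_congr rfl fun j _ ↦ ?_
    rw [smul_smul]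
  -- ★ L6: the coefficient vectors agree
  have hcoeff := coeff_eq_of_transportFun_eq_sum (Motives.familyPullback.snd (W1.univFamilyℂ 𝓜) ι) 2 hU ⟦pth⟧ β hβ hind
    (transportFun_map_fiberι (Motives.familyPullback.snd (W1.univFamilyℂ 𝓜) ι) 2 hU ⟦pth⟧ C) hr₀' hr'
  -- cancel `c ≠ 0` and `2 ≠ 0`, compare the strict upper triangles
  have hupper : ∀ a b, e a < e b → ComplexTorus.intGram (Φ x) p.form a b = ComplexTorus.intGram (Φ x₀) p₀.form a b := by
    intro a b hab
    have h := congrFun hcoeff ⟨(a, b), hab⟩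
    have h2 : ((2 * ComplexTorus.intGram (Φ x₀) p₀.form a b : ℤ) : ℂ) =
        ((2 * ComplexTorus.intGram (Φ x) p.form a b : ℤ) : ℂ) := mul_left_cancel₀ hc h
    have h3 : 2 * ComplexTorus.intGram (Φ x₀) p₀.form a b = 2 * ComplexTorus.intGram (Φ x) p.form a b := by
      exact_mod_cast h2
    omega
  exact eq_of_antisymm_of_upper e hM hM₀ hupper

end UnivFamilyN3corePiece

end Summit.HodgeConjecture.HodgeConjecture.Theorems

end
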